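import Literature.RingTheory.MvPolynomial.RuppertGaoReduction
import Literature.RingTheory.MvPolynomial.GeomComponentCount
import Literature.AlgebraicGeometry.Motives.GeometricallyReducedPerfectField

/-!
# LangWeilTransfer, support item `GoodReduction` (stmt-ValiantsHypothesis-6377) — the absolute
# factorisation of `Q` and the integer minor

Helpers for the general case of `GoodReduction` (route `LangWeilTransfer` of `ValiantsHypothesis`):
for `Q ∈ ℤ[x_0..x_m]` irreducible over `ℚ`,

* `squarefree_map_of_irreducible` — `Q` is squarefree over `ℚ̄` (`ℚ` is perfect: `ℚ̄ ⊗ ℚ[x]/(Q)`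
  is reduced, tree `isReduced_tensorProduct_of_perfectField`);
* `exists_prod_eq_of_squarefree` — a squarefree polynomial over a field is `c · ∏ Pᵢ` with `Pᵢ`
  pairwise non-associated irreducible, their number at most the number of minimal primes over it;
* `exists_int_coeff_minor` — hence (tree `Ruppert.exists_rupMinor_planeSect_ne_zero`, the
  Gao–Ruppert route) a NON-ZERO INTEGER `c`, a coefficient of a minor of size `N − g` of Ruppert's
  matrix of the generic plane section of `Q`, such that modulo every prime `p > deg Q` not dividing
  `c` (and not killing `Q`), every family of pairwise non-associated absolute factors of `Q mod p`
  has at most `g ≤ #geometric components` members (tree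
  `Ruppert.card_add_le_of_map_rupMinor_ne_zero`).

No heights of algebraic numbers enter. Honest framing: bookkeeping for a dormant conditional
route; nothing here bears on VP ≠ VNP.
-/

noncomputable section

open MvPolynomial
open scoped TensorProduct

-- the summit and the problem share the name `ValiantsHypothesis` (D-0017 single-conjunct layout)
set_option linter.dupNamespace false

namespace Summit.ValiantsHypothesis.ValiantsHypothesis.Theorems.LangWeilTransfer

open Literature.RingTheory.MvPolynomial
open Literature.RingTheory.MvPolynomial.Ruppert

/-! ## Squarefree over the algebraic closure -/

/-- **An irreducible polynomial over a perfect field is squarefree over every extension field**: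
`L ⊗_k k[x]/(f) ≅ L[x]/(f)` is reduced. -/
theorem squarefree_map_of_irreducible {k : Type*} [Field k] [PerfectField k] {L : Type*} [Field L]
    [Algebra k L] {σ : Type*} {f : MvPolynomial σ k} (hf : Irreducible f) :
    Squarefree (MvPolynomial.map (algebraMap k L) f) := by
  classical
  set I : Ideal (MvPolynomial σ k) := Ideal.span {f} with hI
  haveI hIp : I.IsPrime :=
    (Ideal.span_singleton_prime hf.ne_zero).2 (UniqueFactorizationMonoid.irreducible_iff_prime.1 hf)
  haveI : IsDomain (MvPolynomial σ k ⧸ I) := (Ideal.Quotient.isDomain_iff_prime I).2 hIp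
  -- `L ⊗ₖ (k[x]/I)` is reduced: it embeds in `L ⊗ₖ Frac(k[x]/I)`, reduced as `k` is perfect
  set B := MvPolynomial σ k ⧸ I
  set E := FractionRing B
  haveI : IsReduced (L ⊗[k] E) :=
    Literature.AlgebraicGeometry.Motives.isReduced_tensorProduct_of_perfectField k L E
  haveI hred : IsReduced (L ⊗[k] B) :=
    isReduced_of_injective
      (Algebra.TensorProduct.map (1 : L →ₐ[k] L) (IsScalarTower.toAlgHom k B E))
      (Module.Flat.lTensor_preserves_injective_linearMap
        ((IsScalarTower.toAlgHom k B E : B →ₐ[k] E) : B →ₗ[k] E) (IsFractionRing.injective B E))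
  -- `L ⊗ₖ k[x]/I ≅ L[x]/(f_L)`
  let e₁ : L ⊗[k] (MvPolynomial σ k ⧸ I) ≃ₐ[L] (L ⊗[k] MvPolynomial σ k) ⧸ I.map
      (Algebra.TensorProduct.includeRight : MvPolynomial σ k →ₐ[k] L ⊗[k] MvPolynomial σ k) :=
    Algebra.TensorProduct.tensorQuotientEquiv (R := k) L (MvPolynomial σ k) L I
  let e₂ : L ⊗[k] MvPolynomial σ k ≃ₐ[L] MvPolynomial σ L := MvPolynomial.algebraTensorAlgEquiv k L
  have he₂ : e₂ (1 ⊗ₜ f) = MvPolynomial.map (algebraMap k L) f := by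
    simp [e₂, MvPolynomial.algebraTensorAlgEquiv_tmul]
  have hJ : (Ideal.span {MvPolynomial.map (algebraMap k L) f} : Ideal (MvPolynomial σ L)) =
      (I.map (Algebra.TensorProduct.includeRight :
        MvPolynomial σ k →ₐ[k] L ⊗[k] MvPolynomial σ k)).map
        (e₂ : L ⊗[k] MvPolynomial σ k →+* MvPolynomial σ L) := by
    rw [hI, Ideal.map_span, Set.image_singleton, Ideal.map_span, Set.image_singleton, ← he₂]
    rfl
  let e₃ := Ideal.quotientEquivAlg _ _ e₂ hJ
  haveI : IsReduced (MvPolynomial σ L ⧸ Ideal.span {MvPolynomial.map (algebraMap k L) f}) :=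
    isReduced_of_injective (e₁.trans e₃).symm.toRingEquiv.toRingHom
      (e₁.trans e₃).symm.toRingEquiv.injective
  -- hence `f_L` is squarefree
  set fL := MvPolynomial.map (algebraMap k L) f with hfL
  have hfL0 : fL ≠ 0 := fun h =>
    hf.ne_zero (MvPolynomial.map_injective _ (algebraMap k L).injective (by rw [← hfL, h, map_zero]))
  intro p hp
  obtain ⟨t, ht⟩ := hp
  have hpt0 : p * t ≠ 0 := by
    intro h0
    apply hfL0
    rw [ht, mul_assoc, h0, mul_zero]
  have hnil : IsNilpotent (Ideal.Quotient.mk (Ideal.span {fL}) (p * t)) := by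
    refine ⟨2, ?_⟩
    rw [← map_pow, Ideal.Quotient.eq_zero_iff_mem, Ideal.mem_span_singleton]
    exact ⟨t, by rw [ht]; ring⟩
  have hzero := hnil.eq_zero
  rw [Ideal.Quotient.eq_zero_iff_mem, Ideal.mem_span_singleton, ht] at hzero
  obtain ⟨s, hs⟩ := hzero
  have h1 : p * t * 1 = p * t * (p * s) := by
    calc p * t * 1 = p * t := mul_one _
      _ = p * p * t * s := hs
      _ = p * t * (p * s) := by ring
  have h2 := mul_left_cancel₀ hpt0 h1
  exact isUnit_iff_exists_inv.mpr ⟨s, h2.symm⟩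

/-! ## The absolute factorisation as a finite product -/

/-- **A squarefree polynomial is a unit times a product of pairwise non-associated
irreducibles**, indexed by `Fin r`, each generating a minimal prime over it. -/
theorem exists_prod_eq_of_squarefree {K : Type*} [Field K] {σ : Type*} {F : MvPolynomial σ K}
    (hF0 : F ≠ 0) (hsq : Squarefree F) :
    ∃ (r : ℕ) (c : K) (_ : c ≠ 0) (P : Fin r → MvPolynomial σ K),
      (∀ i, Irreducible (P i)) ∧ (∀ i j, i ≠ j → ¬ P i ∣ P j) ∧ F = C c * ∏ i, P i ∧
      ∀ i, Ideal.span {P i} ∈ (Ideal.span {F}).minimalPrimes := by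
  classical
  obtain ⟨u, hu⟩ := UniqueFactorizationMonoid.factors_prod hF0
  set M := UniqueFactorizationMonoid.factors F with hM
  obtain ⟨l, hl⟩ := Quot.exists_rep M
  set r := l.length with hr
  set P : Fin r → MvPolynomial σ K := fun i => l.get i with hP
  have hprodl : ∏ i, P i = M.prod := by
    rw [← hl]
    change ∏ i : Fin l.length, l.get i = (l : Multiset (MvPolynomial σ K)).prod
    rw [Multiset.prod_coe, ← List.prod_ofFn, List.ofFn_get]
  have hmem : ∀ i, P i ∈ M := fun i => by
    rw [← hl]; exact List.get_mem l i
  have hirr : ∀ i, Irreducible (P i) := fun i => UniqueFactorizationMonoid.irreducible_of_factor _ (hmem i)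
  -- the unit is a constant
  have hunit : IsUnit ((u : MvPolynomial σ K)) := u.isUnit
  rw [MvPolynomial.isUnit_iff_totalDegree_of_isReduced] at hunit
  obtain ⟨c, hc⟩ : ∃ c, (u : MvPolynomial σ K) = C c := ⟨_, (totalDegree_eq_zero_iff_eq_C).mp hunit.2⟩
  have hc0 : c ≠ 0 := by
    intro h0
    rw [h0, C_0] at hc
    exact u.ne_zero hc
  have hF : F = C c * ∏ i, P i := by rw [hprodl, ← hc, mul_comm, hu]
  -- pairwise non-associated, by squarefreeness
  have hna : ∀ i j, i ≠ j → ¬ P i ∣ P j := by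
    intro i j hij hdvd
    obtain ⟨v, hv⟩ := hdvd
    have hsq' : P i * P i ∣ F := by
      have h2 : P i * P j ∣ ∏ k, P k := by
        rw [← Finset.prod_erase_mul _ _ (Finset.mem_univ i), ← Finset.mul_prod_erase _ _
          (Finset.mem_erase.mpr ⟨Ne.symm hij, Finset.mem_univ j⟩)]
        exact ⟨∏ k ∈ (Finset.univ.erase i).erase j, P k, by ring⟩
      have h3 : P i * P i ∣ P i * P j := ⟨v, by rw [hv]; ring⟩
      exact (h3.trans h2).trans (by rw [hF]; exact dvd_mul_left _ _)
    exact (hirr i).not_isUnit (hsq (P i) hsq')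
  refine ⟨r, c, hc0, P, hirr, hna, hF, fun i => ?_⟩
  rw [minimalPrimes_span_singleton hF0]
  have hdvd : P i ∣ F := by
    rw [hF]; exact dvd_mul_of_dvd_right (Finset.dvd_prod_of_mem _ (Finset.mem_univ i)) _
  exact ⟨P i, ⟨(hirr i).prime, hdvd⟩, rfl⟩

/-- The number of factors is at most the number of minimal primes (when the latter is finite and
counted by `Set.ncard`). -/
theorem card_le_ncard_minimalPrimes {K : Type*} [Field K] {σ : Type*} {F : MvPolynomial σ K}
    {r : ℕ} (P : Fin r → MvPolynomial σ K) (hna : ∀ i j, i ≠ j → ¬ P i ∣ P j)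
    (hmin : ∀ i, Ideal.span {P i} ∈ (Ideal.span {F}).minimalPrimes)
    (hfin : (Ideal.span {F}).minimalPrimes.Finite) :
    r ≤ (Ideal.span {F}).minimalPrimes.ncard := by
  have hinj : Function.Injective (fun i => Ideal.span ({P i} : Set (MvPolynomial σ K))) := by
    intro i j hij
    by_contra hne
    have h : P j ∈ Ideal.span ({P i} : Set (MvPolynomial σ K)) := by
      have : P j ∈ Ideal.span ({P j} : Set (MvPolynomial σ K)) := Ideal.mem_span_singleton_self _
      simp only at hij
      rwa [← hij] at this
    exact hna i j hne (Ideal.mem_span_singleton.mp h)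
  calc r = (Set.range fun i => Ideal.span ({P i} : Set (MvPolynomial σ K))).ncard := by
        rw [Set.ncard_range_of_injective hinj, Nat.card_eq_fintype_card, Fintype.card_fin]
    _ ≤ (Ideal.span {F}).minimalPrimes.ncard :=
        Set.ncard_le_ncard (Set.range_subset_iff.mpr hmin) hfin

/-! ## The integer minor -/

/-- **The integer controlling good reduction.** For `Q ∈ ℤ[x_σ]` (`σ = Fin n`), irreducible over
`ℚ`, of total degree `d ≥ 1`, whose extension to `ℚ̄` has its minimal primes counted by `g > 0`:
there are `k`, rows/columns of a minor of size `k` of Ruppert's matrix of `planeSect Q` with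
`k + r = N` for some `r ≤ g`, and a non-zero integer coefficient `c` of that minor, such that for
every prime `p > d` with `p ∤ c` and `Q mod p ≠ 0`, every family of pairwise non-associated
irreducible factors of `Q` over an algebraically closed field of characteristic `p` has at most
`r` members. -/
theorem exists_int_coeff_minor {n : ℕ} (Q : MvPolynomial (Fin n) ℤ)
    (hQ : Irreducible (MvPolynomial.map (Int.castRingHom ℚ) Q)) (hd : 1 ≤ Q.totalDegree)
    (hpos : 0 < ((Ideal.map (MvPolynomial.map (algebraMap ℚ (AlgebraicClosure ℚ)))
      (Ideal.span {MvPolynomial.map (Int.castRingHom ℚ) Q})).minimalPrimes).ncard) :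
    ∃ (r k : ℕ) (rows : Fin k → (Fin 2 →₀ ℕ)) (cs : Fin k → Col Q.totalDegree) (e : Params n →₀ ℕ),
      r ≤ ((Ideal.map (MvPolynomial.map (algebraMap ℚ (AlgebraicClosure ℚ)))
        (Ideal.span {MvPolynomial.map (Int.castRingHom ℚ) Q})).minimalPrimes).ncard ∧
      k + r = Fintype.card (Col Q.totalDegree) ∧
      (rupMinor Q.totalDegree (planeSect Q) rows cs).coeff e ≠ 0 ∧
      ∀ (p : ℕ) [Fact p.Prime], Q.totalDegree < p →
        ¬ (p : ℤ) ∣ (rupMinor Q.totalDegree (planeSect Q) rows cs).coeff e →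
        ∀ {L : Type} [Field L] [IsAlgClosed L] [CharP L p],
          MvPolynomial.map (Int.castRingHom L) Q ≠ 0 →
          ∀ (s : ℕ) (w : Fin s → MvPolynomial (Fin n) L), (∀ j, Irreducible (w j)) →
            (∀ j l, j ≠ l → ¬ w j ∣ w l) → (∀ j, w j ∣ MvPolynomial.map (Int.castRingHom L) Q) →
            s ≤ r := by
  classical
  set K := AlgebraicClosure ℚ with hK
  -- the absolute factorisation of `Q`
  have hmapQ : MvPolynomial.map (algebraMap ℚ K) (MvPolynomial.map (Int.castRingHom ℚ) Q) =
      MvPolynomial.map (Int.castRingHom K) Q := by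
    rw [MvPolynomial.map_map, RingHom.ext_int ((algebraMap ℚ K).comp (Int.castRingHom ℚ)) (Int.castRingHom K)]
  have hsq : Squarefree (MvPolynomial.map (Int.castRingHom K) Q) := by
    rw [← hmapQ]; exact squarefree_map_of_irreducible hQ
  have hQK0 : MvPolynomial.map (Int.castRingHom K) Q ≠ 0 := by
    rw [← hmapQ]
    exact (map_ne_zero_iff _ (MvPolynomial.map_injective _ (algebraMap ℚ K).injective)).mpr hQ.ne_zero
  obtain ⟨r, c, hc, P, hPirr, hPna, hPprod, hPmin⟩ := exists_prod_eq_of_squarefree hQK0 hsq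
  have hideal : Ideal.map (MvPolynomial.map (algebraMap ℚ K)) (Ideal.span {MvPolynomial.map (Int.castRingHom ℚ) Q})
      = Ideal.span {MvPolynomial.map (Int.castRingHom K) Q} := by
    rw [Ideal.map_span, Set.image_singleton, hmapQ]
  have hfin : (Ideal.span {MvPolynomial.map (Int.castRingHom K) Q}).minimalPrimes.Finite := by
    rw [← hideal]; exact Set.finite_of_ncard_pos hpos
  have hrg : r ≤ ((Ideal.map (MvPolynomial.map (algebraMap ℚ K))
      (Ideal.span {MvPolynomial.map (Int.castRingHom ℚ) Q})).minimalPrimes).ncard := by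
    rw [hideal]; exact card_le_ncard_minimalPrimes P hPna hPmin hfin
  -- the minor over `ℤ[z, μ, v]` and one of its coefficients
  obtain ⟨k, hk, rows, cs, hmin⟩ := exists_rupMinor_planeSect_ne_zero Q hd hc P hPirr hPna hPprod
  obtain ⟨e, he⟩ := MvPolynomial.ne_zero_iff.mp hmin
  refine ⟨r, k, rows, cs, e, hrg, hk, he, ?_⟩
  intro p _ hpd hpc L _ _ _ hQL s w hw hna hdvd
  have hmodp : MvPolynomial.map (Int.castRingHom (ZMod p)) (rupMinor Q.totalDegree (planeSect Q) rows cs) ≠ 0 := by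
    intro h0
    have := congrArg (coeff e) h0
    rw [coeff_map, coeff_zero, eq_intCast, ZMod.intCast_zmod_eq_zero_iff_dvd] at this
    exact hpc this
  have := card_add_le_of_map_rupMinor_ne_zero p Q le_rfl hpd hQL hmodp w hw hna hdvd
  omega

end Summit.ValiantsHypothesis.ValiantsHypothesis.Theorems.LangWeilTransfer
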